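import Mathlib
import HarnessLib
import HarnessLib.Audit
import Summits.CriticalPhenomena.Statement
import Literature.Probability.Percolation.CardyFormula
import HarnessLib.Audit.Status.Attr

/-!
Route: CardyLeeYang

# Route CardyLeeYang — crossing numbers are Poisson-binomial — a Lee–Yang theorem in the
two-boundary fugacity, Cardy as an Euler product

It suffices to show X = PTAR ∧ IDENT (card crossing-number-lee-yang, spine; this route is its first
realisation). PTAR
(CrossingNumberRealRoots, crux 2, EXACT at every mesh): for every conformal rectangle R and every δ
> 0 the number
N_R^δ of open clusters of Ω_δ meeting both discrete arcs (ab)_δ and (cd)_δ — {N ≥ 1} is the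
conjunct's crossing event — is
Poisson-binomial: its probability generating function Φ_R^δ(y) = E[y^N] has only real (negative)
zeros, i.e.
law(N) = law(Σ independent Bernoulli(p_i)). IDENT (StieltjesIdentification, crux 3): the
Euler-product structure that PTAR
forces on every subsequential limit law (support PoissonBinomialLimits: Hurwitz + BK/RSW tightness +
Aizenman's k²-law, no
Poisson part) pins the value 1 − Φ(0) = F(η) on rectilinear conformal rectangles; the proved support
RectilinearSuffices
(stmt-CriticalPhenomena-5663, closed 2026-08-16) carries it to every Jordan conformal rectangle. The
checkpoint crux
StripPressureScaling (rank 4) is where the Lee–Yang input meets the integrable two-boundary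
Temperley–Lieb chain: the
scaled crossing pressure of the bond-ℤ² strip in the doubly-touching fugacity y has the
Dubail–Jacobsen–Saleur form
Ψ(y) = −π((6/π·arccos(√(3y)/2))² − 1)/24 (Ψ(0) = −π/3 the π/3 law, Ψ(1) = 0 stochasticity, Ψ′(1) =
√3/4 Cardy's
crossing-cluster density).
Lean: `CrossingNumberRealRoots ∧ StieltjesIdentification`

## Assembly
`closes : CrossingNumberRealRoots → PoissonBinomialLimits → StieltjesIdentification →
StripPressureScaling → RectilinearSuffices →
CardyFormulaZ2 := fun h1 h2 h3 _ h5 ↦ h5 (h3 (h2 h1))` — pure logic, certified in Sketch.lean (rc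
0): PTAR (h1) feeds the support
PoissonBinomialLimits (h2) to give the Euler-product structure of every limit law,
StieltjesIdentification (h3) turns it into Cardy on
rectilinear conformal rectangles, and the PROVED support RectilinearSuffices (h5) gives the
conjunct; StripPressureScaling is the
idle checkpoint hypothesis (the typed, numerically testable meeting point of Lee–Yang and the 2BTL
chain; its y = 0 value is a
CONSEQUENCE of RectilinearCardy for long rectangles). The Assembly ITEM is the frame statement over
the ranked cruxes alone and is
discharged exactly by the support PoissonBinomialLimits (assembly_of_support in Sketch.lean), not
pure logic.

Rationale: WHY THIS LINE. New object on this problem: the crossing-NUMBER polynomial Φ_Q(y) = E[y^{N_Q}] of a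
planar two-arc graph (in loop language the
two-boundary partition function at n = n₁ = n₂ = 1 with fugacity n₁₂ = y on doubly-touching
clusters, DubailJacobsenSaleur2008 §5.1,
arXiv:0812.2746 p. 14), and the exact conjecture that it is real-rooted precisely for one colour /
two contiguous arcs / simply
connected planar graphs (card evidence: bond-ℤ² boxes to 8×7, sub-arcs, FK q ∈ {1/10,…,16}, 1 375
random planar discs — 0
failures; annuli, interlaced targets, non-planar graphs fail fast; re-checked here exactly on 13
boxes m,n ≤ 4, compute/ptar_small.py).
The proof architecture is imported from algebraic combinatorics — linear preservers of (mutual)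
interlacing (Branden2014 §7–8,
BorceaBranden2009, HeilmannLieb1972, ChudnovskySeymour2007): complementary-arc deletion–contraction
and row growth preserve
interlacing, marked-arc edges never do; a second architecture is Karlin's TP ⇒ PF principle
(Karlin1964, KarlinMcgregor1959)
for the spatial-Markov chain of successive lowest open/dual crossings. In the continuum every
sublimit of N is Poisson-binomial,
Cardy's 1 − F(η) = Π(1 − p_i(η)) is an Euler product and (log Φ)′ a Stieltjes transform; the value
enters through the integrable
two-boundary Temperley–Lieb regularisation (DegierNichols2009; DubailJacobsenSaleur2008 §3–4) for
which PTAR is the Lee–Yang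
(analyticity-in-y, uniform in size) input that Bethe/NLIE evaluations lack. No open route acts on
the law of a COUNT or on zeros
in a boundary fugacity: CardyTotalPositivity posits TP of first-hit POSITIONS (Schoenberg payoff),
CardyPickBootstrap Pick
structure in the CROSS-RATIO, CardyHausdorffMoment complete monotonicity in the SIZE; none of the
three refuted Cardy statements
(stmt-8581, stmt-0748, stmt-6949) concerns crossing numbers.

RANKED CRUXES. #2 CrossingNumberRealRoots (crux) — PTAR for the conjunct's own discretisation (card
K1): for every conformal rectangle R and δ > 0, with G_ω = openGraph ω ⊓ discreteDomainGraph Ω δ and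
N = the number of G_ω-clusters meeting both discreteArc(R.arc 0) and discreteArc(R.arc 2) (events {N
≥ k} = k pairwise G_ω-disconnected arc-0 vertices each G_ω-joined to arc 2), there are p_1,…,p_n ∈
[0,1] with P_{1/2}(N = k) = [X^k]Π_i((1−p_i) + p_i X) for all k — equivalently E[X^N] has only real
zeros. [difficulty: L] (why it might fail: Brändén's 2×2 mutual-interlacing conditions may need more
than the TN₂ signs planarity gives (hidden sign pattern at width ≥ 9 / degree ≥ 9); the G02
largest-component discretisation of a rough Jordan R is not literally a two-arc planar disc (arcs
may interlace at lattice scale).) [Branden2014, BorceaBranden2009, HeilmannLieb1972,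
ChudnovskySeymour2007, Karlin1964, DubailJacobsenSaleur2008, Aizenman1997]
#3 StieltjesIdentification (crux) — the Euler-product structure pins the value (card K3, typed as
the honest implication): IF for every conformal rectangle R every mesh sequence has a subsequence
along which law(N_R^δ) converges to a Poisson-binomial law PB(p), Σp_i < ∞ (the conclusion of
PoissonBinomialLimits), THEN Cardy's formula holds for every conformal rectangle with axis-parallel
rectilinear boundary. Intended proof: identify the Stieltjes measure of each limit via the
two-channel structure of Φ(r,y) on lattice rectangles — open channel Σ_k y^k Σ_n A_{k,n}
e^{−(π/r)(k(2k−1)/3+n)} (Cardy1998 (bb)), closed channel Σ_j B_j(y) e^{−π r x_j(y)} with the 2BTL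
exponents of StripPressureScaling — a Kleban–Zagier-type rigidity with a fugacity, then
corners/polygons by the tree's rectilinear technology. [deps: CrossingNumberRealRoots] [difficulty:
open-problem] (why it might fail: PB structure + pressure fix exponents and all cumulant DENSITIES
of N, not the finite-aspect amplitudes B_j(y); if Lee–Yang gives no grip on amplitudes this item is
no easier than RectilinearCardy (stmt-5660) and the route degenerates to "PTAR + Cardy".)
[KlebanZagier2003, Cardy1998, Cardy2001, DubailJacobsenSaleur2008, DegierNichols2009,
CardyJPhysA1992]
#4 StripPressureScaling (crux) — two-boundary crossing pressure of the bond-ℤ² strip (card K2/K3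
checkpoint, new prediction for y ∉ {0,1}): for y ∈ [0,4/3], with N_{m,L} = number of open clusters
of [0,m]×[0,L] meeting both bottomSide and topSide and Φ_{m,L}(y) = E_{1/2}[y^{N_{m,L}}], the
pressure ψ_L(y) = lim_m log Φ_{m,L}(y)/m exists for every L ≥ 1 and L·ψ_L(y) → Ψ(y) :=
−π((6/π·arccos(√(3y)/2))² − 1)/24 — the ground-state energy −π h_{r₁₂,r₁₂}, h = (r₁₂²−1)/24, of the
two-boundary Temperley–Lieb chain at n = n₁ = n₂ = 1, n₁₂ = y = (4/3)cos²(πr₁₂/6) (DJS eq. for n₁₂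
at r₁ = r₂ = 1, γ = π/3). Checks: Ψ(0) = −π/3 (= StripClusterRates γ₁, stmt-13878), Ψ(1) = 0
(stochastic), Ψ′(1) = √3/4 (Cardy's crossing-cluster density), Ψ(1/3) = −π/8. [deps:
CrossingNumberRealRoots] [difficulty: open-problem] (why it might fail: the DJS spectrum is derived
on the annulus; for the free-end strip the Perron sector could differ for y near 4/3 (level crossing
with h_{r₁₂−2,r₁₂}), and a rigorous 2BTL Bethe/NLIE at Δ = −1/2 with uniform-in-L analyticity in y
is open even given PTAR.) [DubailJacobsenSaleur2008, DegierNichols2009, Cardy1998, Cardy2001,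
DegierEtAl2005, PearceRittenbergDeGierNienhuis2002]
#9 PoissonBinomialLimits (support) — PTAR ⇒ limit structure (card K2, soft half): if
CrossingNumberRealRoots holds then for every conformal rectangle R and every mesh sequence δ_j → 0⁺
there is a subsequence along which P(N_R^δ = k) → r_k for all k, where (r_k) is the Poisson-binomial
law of a summable parameter sequence p ∈ [0,1]^ℕ (coefficient limits of Π_{i<n}((1−p_i)+p_iX));
proof: E[N^δ] ≤ Σ_k P(k disjoint crossings) bounded by BK + RSW uniformly in δ, Hurwitz on the
zero-free PGFs, Aizenman's e^{−αk²} tail (Aizenman1997 Thm) excludes a Poisson component.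
[difficulty: M] [Aizenman1997, Grimmett1999, BollobasRiordan2006, Branden2014]
#9 RectilinearSuffices (support) — Cardy for rectilinear conformal rectangles implies the conjunct —
verbatim stmt-CriticalPhenomena-5663 of route CardyBoundaryCoulombGas, PROVED 2026-08-16
(Theorems.CardyBoundaryCoulombGasAssembly.RectilinearSuffices_proof, Bollobás–Riordan sandwich);
re-asked here so that `closes` may use it. [difficulty: provable-now] [BollobasRiordan2006,
Smirnov2001, stmt-CriticalPhenomena-5663]
#9 BoxCrossingNumberRealRoots (support) — PTAR on lattice boxes, every p (card P3/K1 base family,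
provers' entry point and the refuters' certificate programme): for every p ∈ [0,1], every box
[0,m]×[0,n] and all sub-arcs {0}×[a₁,b₁], {m}×[a₂,b₂] of its left/right sides, the number of open
clusters of the box (openConnIn rectangle) meeting both sub-arcs is Poisson-binomial. Small cases
are finite certificates (exact dyadic arithmetic + Sturm); the general case is the interlacing
induction of crux 2 in its native setting. [difficulty: L] [Branden2014, HeilmannLieb1972,
Grimmett1999]

TWO-LAYER PLAN. CrossingNumberRealRoots ⇐ BoxInterlacingPreserver (the row/column transfer map of
the n-column strip preserves mutual interlacing of the
boundary-state polynomial vector in the planar height order; card (I1)/(I2)) → EdgePeelingClosure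
(complementary-arc deletion–contraction
G = pG/e + (1−p)G∖e keeps the triple pairwise interlacing; Hermite–Kakeya–Obreschkoff) →
CrossingNumberRealRoots (discretisation
bookkeeping: the G02 domain of a conformal rectangle is a planar two-arc graph up to lattice-scale
surgery). StieltjesIdentification ⇐
RectangleTwoChannel (existence of Φ(r,y) = lim E[y^N] on lattice rectangles with both tower forms) →
LeeYangKZRigidity (pure analysis:
a family of Laguerre–Pólya PGFs with those two channel structures and duality Φ(r,0)+Φ(1/r,0)=1 has
Φ(r,0) = 1 − F(λ(r))) →
StieltjesIdentification (polygons by junctions). Nothing filed now.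

KILL CRITERIA. ONE planar two-arc instance (a bond-ℤ² box with sub-arcs, any p) whose
crossing-number PGF has a non-real zero pair refutes
BoxCrossingNumberRealRoots and, if it is a G02 domain, CrossingNumberRealRoots: close
`refuted:CrossingNumberRealRoots` (no pivot — the
route stands or falls with PTAR; a failure only at interlaced lattice-scale arcs of rough domains ⇒
restate on rectilinear R and keep).
Exact transfer-matrix pressures L·ψ_L(y), L ≤ 10, extrapolating away from Ψ(y) at some y ∈ (0,4/3)
refute StripPressureScaling ⇒ the 2BTL
identification is wrong: pivot IDENT's programme to the open channel only (KZ at y = 0, shared with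
tl-spectral cards) and record Lee–Yang as
structural-only. RectilinearCardy (stmt-5660) proved elsewhere moots IDENT; X_U + CardyRigidity
(CardyUniqueLimit) proved elsewhere moots the route's value half.

NOT DECOMPOSED YET. The pathwise skip-free/alternation identity N − N* = ½[1_{T_bot} − 1_{T*_bot} +
1_{T_top} − 1_{T*_top}] (card P2) and the width-2
ladder theorem (card P1) — lemmas under crux 2, attached by provers with --supports; the
Pick/Stieltjes form of (log Φ)′ and the
zero-density (Aizenman) statement — inside PoissonBinomialLimits; amplitudes B_j(y), corner
operators of polygons, and the KZ-type
rigidity theorem — layer-2 children of StieltjesIdentification once StripPressureScaling or PTAR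
closes; FK-q ≠ 1 versions of PTAR (card:
also real-rooted) — not this conjunct.

CHEAPEST FALSIFIER. Exact enumeration: the crossing-number PGF of bond-ℤ² boxes with sub-arcs at
widths 9–10 (transfer matrix, exact integers, Sturm), and
random planar two-arc discs of degree ≥ 9 — one non-real pair kills the line. RAN here
(compute/ptar_small.py, brute force 2^E, exact
Sturm chains, no numpy): boxes (m,n) ∈ {1..4}², 13 cases, degrees 2–5, ALL real-rooted (e.g. 3×3:
counts [6201472, 10137515, 436531,
1697, 1] of 2^24; 3×2 gives P(N=0) = 2^16/2^17 = 1/2, the self-dual check); the card's census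
(widths ≤ 7 all lengths, 8×7, 250 sub-arc
polynomials, 1 375 random planar discs: 0 failures; annulus/interlaced/non-planar controls fail
fast) and the mechanism critic's queued
re-check (kit j007658 part C) stand. Second: exact TM pressures L·ψ_L(1/3) for L ≤ 8 against −π/8.

NUMBERS. h_{r,s} = ((3r−2s)²−1)/24 at c = 0; h_{1,3} = 1/3 (π/3 law, Cardy1992/Cardy1998), h_{1,5} =
2, h_{1,2k+1} = k(2k−1)/3 (Cardy1998 (bb),
Aizenman1997 k²-law); n₁₂(r₁₂) = (4/3)cos²(πr₁₂/6) at n = 1 (DubailJacobsenSaleur2008 eq. for n₁₂,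
r₁ = r₂ = 1, γ = π/3); Ψ(0) = −π/3,
Ψ(1/3) = −π/8 (h_{2,2}), Ψ(1) = 0, Ψ(4/3) = π/24, Ψ′(1) = √3/4 ≈ 0.4330 (crossing-cluster density,
Cardy2001); card zeros 8×7:
p_i = 0.4935, 1.25e-2, 3.7e-4, 2.1e-5, 2.3e-6, 4.2e-7, 1.4e-7; continuum zero spacing p_{k+1}/p_k →
e^{−4πr/3}. Items at open: 7.

DEFINITION REQUESTS. None needed to state the items (N is inlined through the events {N ≥ k} over
openGraph ⊓ discreteDomainGraph / openConnIn rectangle).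
Nice-to-have later: `crossingNumber` as a random variable on Literature.Probability.Percolation
boxes and a `Polynomial.IsRealRooted` /
`Interlaces` API (card D1) — to be requested by the first prover of crux 2, not now.

Novelty: Searches (2026-08-16): `lit search --source crossref "number of spanning clusters percolation
distribution real zeros Lee-Yang"` (8: Fortunato–Aharony–Coniglio–Stauffer PRE 70; Sen IJMPC 8 =
arXiv:cond-mat/9704112, READ: only the tail shape P(n) ~ e^{−an²}; Cardy1998; Shchur–Kosyakov
arXiv:cond-mat/9702248 probabilities of n spanning clusters, numerics); `--source arxiv` same (Sen
×3), `--source zbmath` (0), `--source s2` (429/1 irrelevant); `lit galaxy search "number of spanning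
clusters" --star all` (2: Stauffer–Aharony book, Fortunato–Aharony) and `"distribution of the number
of spanning clusters" --star all` (0); `lit search --source crossref "two-boundary Temperley-Lieb
partition function zeros"` (de Gier–Nichols 2009, Daugherty–Ram 2025, Lieb–Ruelle 1972 — none on
2BTL zeros); `lit read arXiv:0812.2746` pp. 9, 10, 14–15 (n₁₂(r₁₂), E_n, §5.1 percolation, §5.2
Potts dictionary); in-tree census: 55 Theses files + 170 cards of the conjunct (grep Lee-Yang /
real-rooted / Poisson-binomial / crossing number: only the spine card, pgf-zeros-y-system [sector
eigenvalues], lee-yang-cartography [complex √q], jordan-free-crossing-module [E N]); `ledger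
negatives --problem CriticalPhenomena` (3 Cardy negatives, unrelated).
Nearest prior art found: DubailJacobsenSaleur2008 §5.1 (arXiv:0812.2746 p. 14: Z(n₁₂) = 1 + K₀(r₁₂)
− K₀(1) on the ANNULUS, value at n₁₂ = 0 only, zeros never discussed); Aizenman1997 + Cardy1998 +
Sen 1997 (tails and means of N); route CardyTotalPositivity (hidden  [refs: cond-mat/9704112, cond-mat/9702248, 0812.2746, Cardy1998, DubailJacobsenSaleur2008, Aizenman1997]

Barriers (technique_class: lee-yang-zeros, interlacing-preserver, two-boundary-TL): - technique_class: lee-yang-zeros, interlacing-preserver, two-boundary-TL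
- Literature.Barriers.CriticalPhenomena.FKParafermionicHalfCauchyRiemann: evaded by type — the
barrier blocks DETERMINATION of an observable from exact linear vertex identities (the class of
half-CR solutions); PTAR is a family of exact INEQUALITIES of all orders (total positivity of the
Toeplitz matrix of (P(N=k))_k) on a macroscopic counting law and uses no observable, vertex relation
or boundary-value problem; conceded that StieltjesIdentification's lattice regularisation (2BTL at n
= 1) is the integrable structure in which the parafermion also lives — the input taken from it is a
zero-location theorem in the boundary weight, not a vertex identity.
- Literature.Barriers.CriticalPhenomena.EmbeddingModulusUniqueness: applies and is respected — PTAR,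
PoissonBinomialLimits and the Euler-product form are embedding-blind (they hold on sheared lattices
and there describe Beffara's sheared crossing functions); embedding-specific input enters only
through StieltjesIdentification / StripPressureScaling (the isotropic transfer matrix and its π/L
normalisation), the barrier's evasion (i); the route never claims conformal invariance from
positivity alone.
- Literature.Barriers.CriticalPhenomena.SmirnovTriangularOnly: not in class — no colour switching,
separating triple or discrete contour integral; PTAR is the same statement on ℤ², 𝕋 and every planar
two-arc graph.
- Literature.Barriers.CriticalPhenomena.Coverin

sub-problem: CardyFormulaZ2 · status: draft · opened planner-plan-novel-CriticalPhenomena-CardyFormu-1f2e71fb-v2-g9-0 2026-08-16T20:49:20Z · rev 1 · ledger route-CriticalPhenomena-CardyLeeYang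
GENERATED by the gate from the ledger (D-0016/17). Provers cite these decls: `theorem foo : Summit.CriticalPhenomena.CardyFormulaZ2.Theses.CardyLeeYang.<Decl> := …` in Summits/CriticalPhenomena/CardyFormulaZ2/Theorems/<Name>.lean.
-/

namespace Summit.CriticalPhenomena.CardyFormulaZ2.Theses.CardyLeeYang

open scoped BigOperators Topology Manifold Classical MeasureTheory ProbabilityTheory Matrix InnerProductSpace ComplexConjugate ContinuousMap
open Filter Set Function TopologicalSpace MeasureTheory

attribute [summit_statement] _root_.CardyFormulaZ2

/-- item stmt-CriticalPhenomena-16787 · crux · rank 2 · open · by planner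
why it might fail: Brändén's 2×2 mutual-interlacing conditions may need more than the TN₂ signs planarity gives (hidden sign pattern at width ≥ 9 / degree ≥ 9); the G02 largest-component discretisation of a rough Jordan R is not literally a two-arc planar disc (arcs may interlace at lattice scale).
sources: Branden2014, BorceaBranden2009, HeilmannLieb1972, ChudnovskySeymour2007, Karlin1964, DubailJacobsenSaleur2008
[crux] PTAR for the conjunct's own discretisation (card K1): for every conformal rectangle R and δ >
0, with G_ω = openGraph ω ⊓ discreteDomainGraph Ω δ and N = the number of G_ω-clusters meeting both
discreteArc(R.arc 0) and discreteArc(R.arc 2) (events {N ≥ k} = k pairwise G_ω-disconnected arc-0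
vertices each G_ω-joined to arc 2), there are p_1,…,p_n ∈ [0,1] with P_{1/2}(N = k) =
[X^k]Π_i((1−p_i) + p_i X) for all k — equivalently E[X^N] has only real zeros. [difficulty: L] -/
@[route_item "route-CriticalPhenomena-CardyLeeYang", crux]
def CrossingNumberRealRoots : Prop :=
  ∀ (R : Literature.Probability.RandomPlanarGeometry.ConformalRectangle) (δ : ℝ), 0 < δ → let G : Literature.Probability.Percolation.BondConfig (Literature.Probability.LatticeModels.Site 2) → SimpleGraph (Literature.Probability.LatticeModels.Site 2) := fun ω => Literature.Probability.Percolation.openGraph ω ⊓ Literature.Probability.LatticeModels.discreteDomainGraph R.carrier δ; let atLeast : ℕ → Set (Literature.Probability.Percolation.BondConfig (Literature.Probability.LatticeModels.Site 2)) := fun k => {ω | ∃ x : Fin k → Literature.Probability.LatticeModels.Site 2, (∀ i, x i ∈ Literature.Probability.LatticeModels.discreteArc R.carrier δ (R.arc 0) ∧ ∃ y ∈ Literature.Probability.LatticeModels.discreteArc R.carrier δ (R.arc 2), (G ω).Reachable (x i) y) ∧ ∀ i j, i ≠ j → ¬ (G ω).Reachable (x i) (x j)}; ∃ (n : ℕ)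 (p : Fin n → ℝ), (∀ i, 0 ≤ p i ∧ p i ≤ 1) ∧ ∀ k : ℕ, (Literature.Probability.Percolation.bondPercolation (Literature.Probability.LatticeModels.zdGraph 2) Literature.Probability.Percolation.half).real (atLeast k) - (Literature.Probability.Percolation.bondPercolation (Literature.Probability.LatticeModels.zdGraph 2) Literature.Probability.Percolation.half).real (atLeast (k + 1)) = (∏ i, (Polynomial.C (1 - p i) + Polynomial.C (p i) * Polynomial.X)).coeff k

/-- item stmt-CriticalPhenomena-16788 · crux · rank 3 · open · by planner
why it might fail: PB structure + pressure fix exponents and all cumulant DENSITIES of N, not the finite-aspect amplitudes B_j(y); if Lee–Yang gives no grip on amplitudes this item is no easier than RectilinearCardy (stmt-5660) and the route degenerates to "PTAR + Cardy".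
sources: KlebanZagier2003, Cardy1998, Cardy2001, DubailJacobsenSaleur2008, DegierNichols2009, CardyJPhysA1992
[crux] the Euler-product structure pins the value (card K3, typed as the honest implication): IF for
every conformal rectangle R every mesh sequence has a subsequence along which law(N_R^δ) converges
to a Poisson-binomial law PB(p), Σp_i < ∞ (the conclusion of PoissonBinomialLimits), THEN Cardy's
formula holds for every conformal rectangle with axis-parallel rectilinear boundary. Intended proof:
identify the Stieltjes measure of each limit via the two-channel structure of Φ(r,y) on lattice
rectangles — open channel Σ_k y^k Σ_n A_{k,n} e^{−(π/r)(k(2k−1)/3+n)} (Cardy1998 (bb)), closed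
channel Σ_j B_j(y) e^{−π r x_j(y)} with the 2BTL exponents of StripPressureScaling — a
Kleban–Zagier-type rigidity with a fugacity, then corners/polygons by the tree's rectilinear
technology. [deps: CrossingNumberRealRoots] [difficulty: open-problem] -/
@[route_item "route-CriticalPhenomena-CardyLeeYang", crux]
def StieltjesIdentification : Prop :=
  (∀ (R : Literature.Probability.RandomPlanarGeometry.ConformalRectangle) (s : ℕ → ℝ), (∀ j, 0 < s j) → Filter.Tendsto s Filter.atTop (nhds 0) → let G : ℝ → Literature.Probability.Percolation.BondConfig (Literature.Probability.LatticeModels.Site 2) → SimpleGraph (Literature.Probability.LatticeModels.Site 2) := fun δ ω => Literature.Probability.Percolation.openGraph ω ⊓ Literature.Probability.LatticeModels.discreteDomainGraph R.carrier δ; let atLeast : ℝ → ℕ → Set (Literature.Probability.Percolation.BondConfig (Literature.Probability.LatticeModels.Site 2)) := fun δ k => {ω | ∃ x : Fin k → Literature.Probability.LatticeModels.Site 2, (∀ i, x i ∈ Literature.Probability.LatticeModels.discreteArc R.carrier δ (R.arc 0) ∧ ∃ y ∈ Literature.Probability.LatticeModels.discreteArc R.carrier δ (R.arc 2), (G δ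 ω).Reachable (x i) y) ∧ ∀ i j, i ≠ j → ¬ (G δ ω).Reachable (x i) (x j)}; ∃ φ : ℕ → ℕ, StrictMono φ ∧ ∃ (p r : ℕ → ℝ), (∀ i, 0 ≤ p i ∧ p i ≤ 1) ∧ Summable p ∧ (∀ k : ℕ, Filter.Tendsto (fun n : ℕ => (∏ i ∈ Finset.range n, (Polynomial.C (1 - p i) + Polynomial.C (p i) * Polynomial.X)).coeff k) Filter.atTop (nhds (r k))) ∧ ∀ k : ℕ, Filter.Tendsto (fun j : ℕ => (Literature.Probability.Percolation.bondPercolation (Literature.Probability.LatticeModels.zdGraph 2) Literature.Probability.Percolation.half).real (atLeast (s (φ j)) k) - (Literature.Probability.Percolation.bondPercolation (Literature.Probability.LatticeModels.zdGraph 2) Literature.Probability.Percolation.half).real (atLeast (s (φ j)) (k + 1))) Filter.atTop (nhds (r k))) → ∀ R : Literature.Probability.RandomPlanarGeometry.ConformalRectangle, (∃ S : Finset (ℂ × ℂ), (∀ p ∈ S, p.1.re = p.2.re ∨ p.1.im = p.2.im) ∧ frontier R.carrier ⊆ ⋃ p ∈ S, segment ℝ p.1 p.2) → R.HasCrossingLimit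 (Literature.Probability.Percolation.bondDomainCrossingProb R) Literature.Probability.RandomPlanarGeometry.cardyFunction

/-- item stmt-CriticalPhenomena-16789 · crux · rank 4 · open · by planner
why it might fail: the DJS spectrum is derived on the annulus; for the free-end strip the Perron sector could differ for y near 4/3 (level crossing with h_{r₁₂−2,r₁₂}), and a rigorous 2BTL Bethe/NLIE at Δ = −1/2 with uniform-in-L analyticity in y is open even given PTAR.
sources: DubailJacobsenSaleur2008, DegierNichols2009, Cardy1998, Cardy2001, DegierEtAl2005, PearceRittenbergDeGierNienhuis2002
[crux] two-boundary crossing pressure of the bond-ℤ² strip (card K2/K3 checkpoint, new prediction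
for y ∉ {0,1}): for y ∈ [0,4/3], with N_{m,L} = number of open clusters of [0,m]×[0,L] meeting both
bottomSide and topSide and Φ_{m,L}(y) = E_{1/2}[y^{N_{m,L}}], the pressure ψ_L(y) = lim_m log
Φ_{m,L}(y)/m exists for every L ≥ 1 and L·ψ_L(y) → Ψ(y) := −π((6/π·arccos(√(3y)/2))² − 1)/24 — the
ground-state energy −π h_{r₁₂,r₁₂}, h = (r₁₂²−1)/24, of the two-boundary Temperley–Lieb chain at n =
n₁ = n₂ = 1, n₁₂ = y = (4/3)cos²(πr₁₂/6) (DJS eq. for n₁₂ at r₁ = r₂ = 1, γ = π/3). Checks: Ψ(0) =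
−π/3 (= StripClusterRates γ₁, stmt-13878), Ψ(1) = 0 (stochastic), Ψ′(1) = √3/4 (Cardy's
crossing-cluster density), Ψ(1/3) = −π/8. [deps: CrossingNumberRealRoots] [difficulty: open-problem] -/
@[route_item "route-CriticalPhenomena-CardyLeeYang", crux]
def StripPressureScaling : Prop :=
  ∀ y : ℝ, 0 ≤ y → y ≤ 4 / 3 → let atLeast : ℕ → ℕ → ℕ → Set (Literature.Probability.Percolation.BondConfig (Literature.Probability.LatticeModels.Site 2)) := fun m L k => {ω | ∃ x : Fin k → Literature.Probability.LatticeModels.Site 2, (∀ i, x i ∈ (Literature.Probability.Percolation.bottomSide m L : Set (Literature.Probability.LatticeModels.Site 2)) ∧ ∃ z ∈ (Literature.Probability.Percolation.topSide m L : Set (Literature.Probability.LatticeModels.Site 2)), ω ∈ Literature.Probability.Percolation.openConnIn (Literature.Probability.Percolation.rectangle m L : Set (Literature.Probability.LatticeModels.Site 2)) (x i) z) ∧ ∀ i j, i ≠ j → ω ∉ Literature.Probability.Percolation.openConnIn (Literature.Probability.Percolation.rectangle m L : Set (Literature.Probability.LatticeModels.Site 2)) (x i) (x j)}; let Φ : ℕ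 → ℕ → ℝ := fun m L => ∑ k ∈ Finset.range ((m + 1) * (L + 1) + 1), ((Literature.Probability.Percolation.bondPercolation (Literature.Probability.LatticeModels.zdGraph 2) Literature.Probability.Percolation.half).real (atLeast m L k) - (Literature.Probability.Percolation.bondPercolation (Literature.Probability.LatticeModels.zdGraph 2) Literature.Probability.Percolation.half).real (atLeast m L (k + 1))) * y ^ k; ∃ ψ : ℕ → ℝ, (∀ L : ℕ, 1 ≤ L → Filter.Tendsto (fun m : ℕ => Real.log (Φ m L) / (m : ℝ)) Filter.atTop (nhds (ψ L))) ∧ Filter.Tendsto (fun L : ℕ => (L : ℝ) * ψ L) Filter.atTop (nhds (-(Real.pi * ((6 / Real.pi * Real.arccos (Real.sqrt (3 * y) / 2)) ^ 2 - 1) / 24)))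

/-- item stmt-CriticalPhenomena-16790 · crux · rank 9 · open · by planner
why it might fail: Tightness is BK+RSW, but excluding a Poisson component needs Aizenman's e^{-αk²} tail on GENERAL Jordan conformal rectangles under the G02 discretisation (rough boundary, lattice-degenerate arcs, cf. stmt-0748); a geometric tail alone does not make the limit PGF entire.
sources: Aizenman1997, Grimmett1999, BollobasRiordan2006, Branden2014
[support] PTAR ⇒ limit structure (card K2, soft half): if CrossingNumberRealRoots holds then for
every conformal rectangle R and every mesh sequence δ_j → 0⁺ there is a subsequence along which
P(N_R^δ = k) → r_k for all k, where (r_k) is the Poisson-binomial law of a summable parameter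
sequence p ∈ [0,1]^ℕ (coefficient limits of Π_{i<n}((1−p_i)+p_iX)); proof: E[N^δ] ≤ Σ_k P(k disjoint
crossings) bounded by BK + RSW uniformly in δ, Hurwitz on the zero-free PGFs, Aizenman's e^{−αk²}
tail (Aizenman1997 Thm) excludes a Poisson component. [difficulty: M] -/
@[route_item "route-CriticalPhenomena-CardyLeeYang", crux]
def PoissonBinomialLimits : Prop :=
  (∀ (R : Literature.Probability.RandomPlanarGeometry.ConformalRectangle) (δ : ℝ), 0 < δ → let G : Literature.Probability.Percolation.BondConfig (Literature.Probability.LatticeModels.Site 2) → SimpleGraph (Literature.Probability.LatticeModels.Site 2) := fun ω => Literature.Probability.Percolation.openGraph ω ⊓ Literature.Probability.LatticeModels.discreteDomainGraph R.carrier δ; let atLeast : ℕ → Set (Literature.Probability.Percolation.BondConfig (Literature.Probability.LatticeModels.Site 2)) := fun k => {ω | ∃ x : Fin k → Literature.Probability.LatticeModels.Site 2, (∀ i, x i ∈ Literature.Probability.LatticeModels.discreteArc R.carrier δ (R.arc 0) ∧ ∃ y ∈ Literature.Probability.LatticeModels.discreteArc R.carrier δ (R.arc 2), (G ω).Reachable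 (x i) y) ∧ ∀ i j, i ≠ j → ¬ (G ω).Reachable (x i) (x j)}; ∃ (n : ℕ) (p : Fin n → ℝ), (∀ i, 0 ≤ p i ∧ p i ≤ 1) ∧ ∀ k : ℕ, (Literature.Probability.Percolation.bondPercolation (Literature.Probability.LatticeModels.zdGraph 2) Literature.Probability.Percolation.half).real (atLeast k) - (Literature.Probability.Percolation.bondPercolation (Literature.Probability.LatticeModels.zdGraph 2) Literature.Probability.Percolation.half).real (atLeast (k + 1)) = (∏ i, (Polynomial.C (1 - p i) + Polynomial.C (p i) * Polynomial.X)).coeff k) → ∀ (R : Literature.Probability.RandomPlanarGeometry.ConformalRectangle) (s : ℕ → ℝ), (∀ j, 0 < s j) → Filter.Tendsto s Filter.atTop (nhds 0) → let G : ℝ → Literature.Probability.Percolation.BondConfig (Literature.Probability.LatticeModels.Site 2) → SimpleGraph (Literature.Probability.LatticeModels.Site 2) := fun δ ω => Literature.Probability.Percolation.openGraph ω ⊓ Literature.Probability.LatticeModels.discreteDomainGraph R.carrier δ; let atLeast : ℝ → ℕ → Set (Literature.Probability.Percolation.BondConfig (Literature.Probability.LatticeModels.Site 2)) := fun δ k =>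 {ω | ∃ x : Fin k → Literature.Probability.LatticeModels.Site 2, (∀ i, x i ∈ Literature.Probability.LatticeModels.discreteArc R.carrier δ (R.arc 0) ∧ ∃ y ∈ Literature.Probability.LatticeModels.discreteArc R.carrier δ (R.arc 2), (G δ ω).Reachable (x i) y) ∧ ∀ i j, i ≠ j → ¬ (G δ ω).Reachable (x i) (x j)}; ∃ φ : ℕ → ℕ, StrictMono φ ∧ ∃ (p r : ℕ → ℝ), (∀ i, 0 ≤ p i ∧ p i ≤ 1) ∧ Summable p ∧ (∀ k : ℕ, Filter.Tendsto (fun n : ℕ => (∏ i ∈ Finset.range n, (Polynomial.C (1 - p i) + Polynomial.C (p i) * Polynomial.X)).coeff k) Filter.atTop (nhds (r k))) ∧ ∀ k : ℕ, Filter.Tendsto (fun j : ℕ => (Literature.Probability.Percolation.bondPercolation (Literature.Probability.LatticeModels.zdGraph 2) Literature.Probability.Percolation.half).real (atLeast (s (φ j)) k) - (Literature.Probability.Percolation.bondPercolation (Literature.Probability.LatticeModels.zdGraph 2) Literature.Probability.Percolation.half).real (atLeast (s (φ j)) (k + 1))) Filter.atTop (nhds (r k))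

/-- item stmt-CriticalPhenomena-16791 · crux · rank 9 · open · by planner
why it might fail: None mathematically: verbatim PROVED in the tree (Theorems.CardyBoundaryCoulombGasAssembly.RectilinearSuffices_proof closes stmt-5663, 2026-08-16); only bookkeeping risk (id not deduplicated onto 5663) — a one-line Theorems file `:= RectilinearSuffices_proof` closes it.
sources: BollobasRiordan2006, Smirnov2001, stmt-CriticalPhenomena-5663
[support] Cardy for rectilinear conformal rectangles implies the conjunct — verbatim
stmt-CriticalPhenomena-5663 of route CardyBoundaryCoulombGas, PROVED 2026-08-16
(Theorems.CardyBoundaryCoulombGasAssembly.RectilinearSuffices_proof, Bollobás–Riordan sandwich);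
re-asked here so that `closes` may use it. [difficulty: provable-now] -/
@[route_item "route-CriticalPhenomena-CardyLeeYang", crux]
def RectilinearSuffices : Prop :=
  (∀ R : Literature.Probability.RandomPlanarGeometry.ConformalRectangle, (∃ S : Finset (ℂ × ℂ), (∀ p ∈ S, p.1.re = p.2.re ∨ p.1.im = p.2.im) ∧ frontier R.carrier ⊆ ⋃ p ∈ S, segment ℝ p.1 p.2) → R.HasCrossingLimit (Literature.Probability.Percolation.bondDomainCrossingProb R) Literature.Probability.RandomPlanarGeometry.cardyFunction) → CardyFormulaZ2

/-- item stmt-CriticalPhenomena-16792 · support · rank 9 · open · by planner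
sources: Branden2014, HeilmannLieb1972, Grimmett1999
[support] PTAR on lattice boxes, every p (card P3/K1 base family, provers' entry point and the
refuters' certificate programme): for every p ∈ [0,1], every box [0,m]×[0,n] and all sub-arcs
{0}×[a₁,b₁], {m}×[a₂,b₂] of its left/right sides, the number of open clusters of the box (openConnIn
rectangle) meeting both sub-arcs is Poisson-binomial. Small cases are finite certificates (exact
dyadic arithmetic + Sturm); the general case is the interlacing induction of crux 2 in its native
setting. [difficulty: L] -/
@[route_item "route-CriticalPhenomena-CardyLeeYang"]
def BoxCrossingNumberRealRoots : Prop :=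
  ∀ (p₀ : unitInterval) (m n a₁ b₁ a₂ b₂ : ℕ), a₁ ≤ b₁ → b₁ ≤ n → a₂ ≤ b₂ → b₂ ≤ n → let atLeast : ℕ → Set (Literature.Probability.Percolation.BondConfig (Literature.Probability.LatticeModels.Site 2)) := fun k => {ω | ∃ x : Fin k → Literature.Probability.LatticeModels.Site 2, (∀ i, x i ∈ (Literature.Probability.Percolation.leftSide m n : Set (Literature.Probability.LatticeModels.Site 2)) ∧ (a₁ : ℤ) ≤ x i 1 ∧ x i 1 ≤ (b₁ : ℤ) ∧ ∃ z ∈ (Literature.Probability.Percolation.rightSide m n : Set (Literature.Probability.LatticeModels.Site 2)), (a₂ : ℤ) ≤ z 1 ∧ z 1 ≤ (b₂ : ℤ) ∧ ω ∈ Literature.Probability.Percolation.openConnIn (Literature.Probability.Percolation.rectangle m n : Set (Literature.Probability.LatticeModels.Site 2)) (x i) z) ∧ ∀ i j, i ≠ j → ω ∉ Literature.Probability.Percolation.openConnIn (Literature.Probability.Percolation.rectangle m n : Set (Literature.Probability.LatticeModels.Site 2)) (x i) (x j)}; ∃ (N : ℕ) (p : Fin N → ℝ), (∀ i, 0 ≤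 p i ∧ p i ≤ 1) ∧ ∀ k : ℕ, (Literature.Probability.Percolation.bondPercolation (Literature.Probability.LatticeModels.zdGraph 2) p₀).real (atLeast k) - (Literature.Probability.Percolation.bondPercolation (Literature.Probability.LatticeModels.zdGraph 2) p₀).real (atLeast (k + 1)) = (∏ i, (Polynomial.C (1 - p i) + Polynomial.C (p i) * Polynomial.X)).coeff k

/-- item stmt-CriticalPhenomena-16793 · assembly · rank 1 · open · by planner
sources: Smirnov2001, CardyJPhysA1992
[assembly] CrossingNumberRealRoots → StieltjesIdentification → StripPressureScaling →
RectilinearSuffices → CardyFormulaZ2 (needs the support PoissonBinomialLimits). -/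
@[route_item "route-CriticalPhenomena-CardyLeeYang"]
def Assembly : Prop :=
  CrossingNumberRealRoots → StieltjesIdentification → StripPressureScaling → RectilinearSuffices → CardyFormulaZ2

/-! D-0027 §2.1 — DECIDING THEOREM (planner-authored via `route open/edit --closes-file`; by planner-plan-novel-CriticalPhenomena-CardyFormu-1f2e71fb-v2- 2026-08-16T20:49:20Z):
its hypotheses are this route's items and its conclusion the sub-problem Statement (glue_lint), and it elaborates with this file. -/

@[closes "route-CriticalPhenomena-CardyLeeYang"] theorem closes : CrossingNumberRealRoots → PoissonBinomialLimits → StieltjesIdentification → StripPressureScaling → RectilinearSuffices → _root_.CardyFormulaZ2 :=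
  fun h_CrossingNumberRealRoots h_PoissonBinomialLimits h_StieltjesIdentification _h_StripPressureScaling h_RectilinearSuffices =>
    h_RectilinearSuffices (h_StieltjesIdentification (h_PoissonBinomialLimits h_CrossingNumberRealRoots))

end Summit.CriticalPhenomena.CardyFormulaZ2.Theses.CardyLeeYang
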